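import Literature.Analysis.FluidPDE.CylindricalGenerator
import HarnessLib

/-!
# Stub `stub_projectedStress` of line `cutoff_compactness` (crux stmt-AnomalousDissipation-18402,
  `TameRoughRigidity.TameClosure`)

**The Galerkin-projected Reynolds stress and the spectral tail.** Two tools of the Galerkin
cut-off argument (Foias–Manley–Rosa–Temam 2001, Ch. IV App. B.1) on the energy space
`H = L²_σ(T³)`, with `P_K` the Fourier truncation `Torus.fourierTruncate K`:

1. For a smooth field `g` there is `C ≥ 0` (twice a bound `C_g` on `∑ⱼ ‖∂ⱼ g‖`,
   `Torus.exists_sum_norm_partialDeriv_le`) such that for every order `K` the projected stress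
   `q(v) = ∫ (P_K v ⊗ P_K v) : ∇g = Torus.inertialPairing (P_K v) g` is continuous on `H`
   (the map `v ↦ P_K v ∈ L²` is the finite frame expansion `∑_p (v, e_p) e_p`,
   `Torus.sum_integral_inner_frameField_smul`, with continuous coefficients), satisfies
   `|q(v)| ≤ C_g |P_K v|²` (`Torus.integrable_inner_fderiv_apply_coe`), and
   `|∫ (v ⊗ v) : ∇g − q(v)| = |∫ ⟪(∇g) v, v − P_K v⟫ + ∫ ⟪(∇g)(v − P_K v), P_K v⟫| ≤ C |v| ‖v − P_K v‖₂`.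
2. The pointwise spectral tail bound `4π²(K²+1) ∫ ‖v − P_K v‖² ≤ ‖∇v‖₂²` in `ℝ≥0∞`
   (`Torus.lintegral_enorm_sq_fourierTruncate_sub_le`, `Torus.tailGradNormSq_le`).

## References

* C. Foias, O. Manley, R. Rosa, R. Temam, *Navier–Stokes Equations and Turbulence* (CUP 2001),
  Ch. IV (1.14) p. 193; App. B.1 (B.10)–(B.11). [FoiasManleyRosaTemam2001]
-/

set_option linter.dupNamespace false

noncomputable section

namespace Summit.AnomalousDissipation.AnomalousDissipation.Theorems.TameRoughRigidity.TameClosure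

open MeasureTheory Filter Topology UnitAddTorus
open scoped InnerProductSpace RealInnerProductSpace ENNReal NNReal
open Literature.Analysis.FunctionSpaces Literature.Analysis.FluidPDE

/-- Local notation: real vector fields on `T³`. -/
local notation "Vec3" => (UnitAddTorus (Fin 3)) → (EuclideanSpace ℝ (Fin 3))
/-- Local notation: `L²(T³; ℝ³)`. -/
local notation "L2" => (Lp (EuclideanSpace ℝ (Fin 3)) 2 (volume : Measure (UnitAddTorus (Fin 3))))
/-- Local notation: the energy space `H`. -/
local notation "H3" => (Torus.energySpace (Fin 3))

/-! ### The `L²` class of the Galerkin truncation and its frame expansion -/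

/-- The frame fields of the Galerkin frame are smooth. [folklore] -/
private theorem isSmooth_frameFieldIdx (K : ℕ) (p : Torus.FrameIdx (Fin 3) K) :
    Torus.IsSmooth (Torus.frameFieldIdx K p) :=
  Torus.isSmooth_realTrigPoly _ _

/-- Local notation: the `L²` class of the Galerkin truncation `P_K v` of `v ∈ H`. -/
local notation "𝒫[" K ", " v "]" =>
  (MemLp.toLp (Torus.fourierTruncate K (((v : L2)) : Vec3))
    (Torus.memLp_fourierTruncate K (((v : L2)) : Vec3) 2))
/-- Local notation: the `L²` class of the frame field `e_p` of the Galerkin frame of order `K`. -/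
local notation "𝓔[" K ", " p "]" =>
  (MemLp.toLp (Torus.frameFieldIdx K p) (Torus.IsSmooth.memLp (isSmooth_frameFieldIdx K p) 2))

/-- The class `P_K v ∈ L²` is represented by the function `P_K v`. [folklore] -/
private theorem coeFn_truncLp (K : ℕ) (v : H3) :
    ((𝒫[K, v] : L2) : Vec3) =ᵐ[volume] Torus.fourierTruncate K (((v : L2)) : Vec3) :=
  MemLp.coeFn_toLp _

/-- **The frame reproduces the truncation**, indexed by `FrameIdx`: for `v ∈ H`,
`P_K v (x) = ∑_p (v, e_p) e_p(x)`. [folklore] -/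
private theorem fourierTruncate_coe_eq_sum_frameFieldIdx (K : ℕ) (v : H3)
    (x : UnitAddTorus (Fin 3)) :
    Torus.fourierTruncate K (((v : L2)) : Vec3) x =
      ∑ p : Torus.FrameIdx (Fin 3) K,
        Torus.pairing (v : L2) (Torus.frameFieldIdx K p) • Torus.frameFieldIdx K p x := by
  rw [← Torus.sum_integral_inner_frameField_smul v.2 K x, Fintype.sum_prod_type,
    ← Finset.sum_coe_sort (Torus.freqBall₀ K)]
  refine Finset.sum_congr rfl fun k _ => ?_
  rw [Fintype.sum_prod_type]
  rfl

/-- Almost-everywhere form of a finite combination of `L²` classes with given representatives.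
[folklore] -/
private theorem coeFn_finsetSum_smul_of_ae_eq {ι : Type*} (s : Finset ι) (c : ι → ℝ)
    (F : ι → L2) (f : ι → Vec3) (hF : ∀ i ∈ s, ((F i : L2) : Vec3) =ᵐ[volume] f i) :
    ((∑ i ∈ s, c i • F i : L2) : Vec3) =ᵐ[volume] fun x => ∑ i ∈ s, c i • f i x := by
  classical
  induction s using Finset.induction_on with
  | empty =>
    simp only [Finset.sum_empty]
    filter_upwards [Lp.coeFn_zero (EuclideanSpace ℝ (Fin 3)) 2
      (volume : Measure (UnitAddTorus (Fin 3)))] with x hx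
    rw [hx, Pi.zero_apply]
  | insert a s ha ih =>
    rw [Finset.sum_insert ha]
    filter_upwards [Lp.coeFn_add (c a • F a) (∑ i ∈ s, c i • F i), Lp.coeFn_smul (c a) (F a),
      hF a (Finset.mem_insert_self a s), ih fun i hi => hF i (Finset.mem_insert_of_mem hi)]
      with x h1 h2 h3 h4
    rw [h1, Pi.add_apply, h2, Pi.smul_apply, h3, h4, Finset.sum_insert ha]

/-- The frame expansion in `L²`: `P_K v = ∑_p (v, e_p) e_p` as `L²` classes. [folklore] -/
private theorem truncLp_eq_sum (K : ℕ) (v : H3) :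
    𝒫[K, v] = ∑ p : Torus.FrameIdx (Fin 3) K,
      Torus.pairing (v : L2) (Torus.frameFieldIdx K p) • 𝓔[K, p] := by
  refine Lp.ext ?_
  have h2 := coeFn_finsetSum_smul_of_ae_eq Finset.univ
    (fun p => Torus.pairing (v : L2) (Torus.frameFieldIdx K p)) (fun p => 𝓔[K, p])
    (fun p => Torus.frameFieldIdx K p) fun p _ => MemLp.coeFn_toLp _
  filter_upwards [coeFn_truncLp K v, h2] with x hx1 hx2
  rw [hx1, hx2, fourierTruncate_coe_eq_sum_frameFieldIdx]

/-- `v ↦ P_K v` is continuous from `H` to `L²` (finite frame expansion with continuous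
coefficients). [folklore] -/
private theorem continuous_truncLp (K : ℕ) : Continuous fun v : H3 => 𝒫[K, v] := by
  have h : (fun v : H3 => 𝒫[K, v]) = fun v : H3 => ∑ p : Torus.FrameIdx (Fin 3) K,
      Torus.pairing (v : L2) (Torus.frameFieldIdx K p) • 𝓔[K, p] :=
    funext fun v => truncLp_eq_sum K v
  rw [h]
  exact continuous_finsetSum _ fun p _ =>
    (Torus.continuous_pairing_coe ((isSmooth_frameFieldIdx K p).memLp 2)).smul continuous_const

/-- `‖P_K v‖² = |P_K v|² = truncNormSq K v`. [folklore] -/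
private theorem norm_truncLp_sq (K : ℕ) (v : H3) :
    ‖𝒫[K, v]‖ ^ 2 = Torus.truncNormSq K v := by
  rw [← Torus.integral_norm_sq_coe_eq, Torus.truncNormSq]
  refine integral_congr_ae ?_
  filter_upwards [coeFn_truncLp K v] with x hx
  rw [hx]

/-- Bessel: `‖P_K v‖ ≤ |v|`. [folklore] -/
private theorem norm_truncLp_le (K : ℕ) (v : H3) : ‖𝒫[K, v]‖ ≤ ‖v‖ := by
  have h : ‖𝒫[K, v]‖ ^ 2 ≤ ‖v‖ ^ 2 := by
    rw [norm_truncLp_sq]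
    exact Torus.truncNormSq_le K v
  exact (pow_le_pow_iff_left₀ (norm_nonneg _) (norm_nonneg _) two_ne_zero).1 h

/-- The `L²` norm of the tail class `v − P_K v` is `(∫ ‖v − P_K v‖²)^{1/2}`. [folklore] -/
private theorem norm_sub_truncLp_eq_sqrt (K : ℕ) (v : H3) :
    ‖(v : L2) - 𝒫[K, v]‖ =
      Real.sqrt (∫ x, ‖(((v : L2)) : Vec3) x -
        Torus.fourierTruncate K (((v : L2)) : Vec3) x‖ ^ 2) := by
  rw [← Real.sqrt_sq (norm_nonneg _), ← Torus.integral_norm_sq_coe_eq]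
  congr 1
  refine integral_congr_ae ?_
  filter_upwards [Lp.coeFn_sub (v : L2) (𝒫[K, v]), coeFn_truncLp K v] with x h1 h2
  rw [h1, Pi.sub_apply, h2]

/-! ### (1) The projected Reynolds stress -/

/-- **The Galerkin-projected Reynolds stress.** For a smooth field `g` there is `C ≥ 0` such that
for every order `K` the projected stress `q(v) = ∫ (P_K v ⊗ P_K v) : ∇g` is continuous on `H`,
`|q(v)| ≤ B |P_K v|²`, and `|∫ (v ⊗ v) : ∇g − q(v)| ≤ C |v| ‖v − P_K v‖₂`
(`∫ (v⊗v):∇g − q(v) = ∫ ⟪(∇g) v, v − P_K v⟫ + ∫ ⟪(∇g)(v − P_K v), P_K v⟫`, each term bounded by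
the `L²` boundedness of the convective bilinear form).
[cite: FoiasManleyRosaTemam2001, Ch. IV App. B.1 (B.10)–(B.11)] -/
theorem projectedStress_stress (g : Vec3) (hg : Torus.IsSmooth g) :
    ∃ C : ℝ, 0 ≤ C ∧ ∀ K : ℕ, ∃ (q : H3 → ℝ) (B : ℝ),
      Continuous q ∧ (∀ v : H3, |q v| ≤ B * Torus.truncNormSq K v) ∧
      ∀ v : H3, |Torus.inertialPairing (v : L2) g - q v| ≤
        C * ‖v‖ * Real.sqrt (∫ x, ‖(((v : L2)) : Vec3) x -
          Torus.fourierTruncate K (((v : L2)) : Vec3) x‖ ^ 2) := by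
  obtain ⟨C, hC0, hC⟩ := Torus.exists_sum_norm_partialDeriv_le hg
  refine ⟨2 * C, by positivity, fun K => ⟨fun v => Torus.inertialPairing (𝒫[K, v]) g, C,
    (Torus.continuous_inertialPairing hg).comp (continuous_truncLp K), fun v => ?_, fun v => ?_⟩⟩
  · -- `|q(v)| ≤ C ‖P_K v‖² = C |P_K v|²`
    show |Torus.inertialPairing (𝒫[K, v]) g| ≤ C * Torus.truncNormSq K v
    rw [← norm_truncLp_sq, sq]
    exact (Torus.integrable_inner_fderiv_apply_coe hg hC (𝒫[K, v]) (𝒫[K, v])).2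
  · -- the error `B(v, v) − B(Pv, Pv) = B(v, v − Pv) + B(v − Pv, Pv)`
    show |Torus.inertialPairing (v : L2) g - Torus.inertialPairing (𝒫[K, v]) g| ≤ _
    set B : L2 → L2 → ℝ := fun a b =>
      ∫ x, ⟪Torus.fderiv g x ((a : Vec3) x), (b : Vec3) x⟫ with hB
    have hBi := fun a b => (Torus.integrable_inner_fderiv_apply_coe hg hC a b).1
    have hBb : ∀ a b, |B a b| ≤ C * (‖a‖ * ‖b‖) := fun a b =>
      (Torus.integrable_inner_fderiv_apply_coe hg hC a b).2
    -- adapted from `Torus.continuous_inertialPairing` (CylindricalGenerator)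
    have hBsub₁ : ∀ a₁ a₂ b, B (a₁ - a₂) b = B a₁ b - B a₂ b := by
      intro a₁ a₂ b
      simp only [hB]
      rw [← integral_sub (hBi a₁ b) (hBi a₂ b)]
      refine integral_congr_ae ?_
      filter_upwards [Lp.coeFn_sub a₁ a₂] with x hx
      rw [hx, Pi.sub_apply, map_sub, inner_sub_left]
    have hBsub₂ : ∀ a b₁ b₂, B a (b₁ - b₂) = B a b₁ - B a b₂ := by
      intro a b₁ b₂
      simp only [hB]
      rw [← integral_sub (hBi a b₁) (hBi a b₂)]
      refine integral_congr_ae ?_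
      filter_upwards [Lp.coeFn_sub b₁ b₂] with x hx
      rw [hx, Pi.sub_apply, inner_sub_right]
    have hQ : ∀ u : L2, Torus.inertialPairing u g = B u u := fun u => rfl
    have hdiff : ∀ w P : L2, Torus.inertialPairing w g - Torus.inertialPairing P g =
        B w (w - P) + B (w - P) P := by
      intro w P
      rw [hQ, hQ, hBsub₁, hBsub₂]
      ring
    rw [hdiff, ← norm_sub_truncLp_eq_sqrt K v]
    have hPle : ‖𝒫[K, v]‖ ≤ ‖v‖ := norm_truncLp_le K v
    have hwv : ‖(v : L2)‖ = ‖v‖ := rfl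
    calc |B (v : L2) ((v : L2) - 𝒫[K, v]) + B ((v : L2) - 𝒫[K, v]) (𝒫[K, v])|
        ≤ |B (v : L2) ((v : L2) - 𝒫[K, v])| + |B ((v : L2) - 𝒫[K, v]) (𝒫[K, v])| :=
          abs_add_le _ _
      _ ≤ C * (‖(v : L2)‖ * ‖(v : L2) - 𝒫[K, v]‖) +
            C * (‖(v : L2) - 𝒫[K, v]‖ * ‖𝒫[K, v]‖) := add_le_add (hBb _ _) (hBb _ _)
      _ ≤ C * (‖v‖ * ‖(v : L2) - 𝒫[K, v]‖) + C * (‖(v : L2) - 𝒫[K, v]‖ * ‖v‖) := by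
          rw [hwv]
          gcongr
      _ = 2 * C * ‖v‖ * ‖(v : L2) - 𝒫[K, v]‖ := by ring

/-! ### (2) The spectral tail -/

/-- **The spectral tail bound**, pointwise in `ℝ≥0∞`: `4π²(K²+1) ∫ ‖v − P_K v‖² ≤ ‖∇v‖₂²` for
`v ∈ H` (the modes of `v − P_K v` live at `|k|² ≥ K² + 1`).
[cite: FoiasManleyRosaTemam2001, Ch. IV (1.14), p. 193] -/
theorem projectedStress_tail (K : ℕ) (v : H3) :
    ENNReal.ofReal (4 * Real.pi ^ 2 * ((K : ℝ) ^ 2 + 1)) *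
        ENNReal.ofReal (∫ x, ‖(((v : L2)) : Vec3) x -
          Torus.fourierTruncate K (((v : L2)) : Vec3) x‖ ^ 2) ≤
      Torus.eGradNormSq (((v : L2)) : Vec3) := by
  have hmem : MemLp (((v : L2)) : Vec3) 2 volume := Lp.memLp _
  have hsub : MemLp (fun x => (((v : L2)) : Vec3) x -
      Torus.fourierTruncate K (((v : L2)) : Vec3) x) 2 volume :=
    hmem.sub (Torus.memLp_fourierTruncate K _ 2)
  have hswap :
      (∫⁻ x, ‖Torus.fourierTruncate K (((v : L2)) : Vec3) x - (((v : L2)) : Vec3) x‖ₑ ^ 2) =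
        ∫⁻ x, ‖(((v : L2)) : Vec3) x - Torus.fourierTruncate K (((v : L2)) : Vec3) x‖ₑ ^ 2 :=
    lintegral_congr fun x => by rw [enorm_sub_rev]
  rw [ENNReal.ofReal_mul (by positivity), Torus.ofReal_integral_norm_sq_eq_lintegral hsub,
    ← hswap]
  exact (Torus.lintegral_enorm_sq_fourierTruncate_sub_le hmem K).trans
    (Torus.tailGradNormSq_le K _)

/-! ### The registered stub -/

/-- **S2c `stub_projectedStress`** — THE GALERKIN-PROJECTED REYNOLDS STRESS AND THE SPECTRAL TAIL:
(1) for a smooth field `g` there is `C ≥ 0` such that for every order `K` the projected stress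
`q(v) = ∫ (P_K v ⊗ P_K v) : ∇g` is continuous on `H`, `|q(v)| ≤ B |P_K v|²` and
`|∫ (v ⊗ v) : ∇g − q(v)| ≤ C |v| ‖v − P_K v‖₂`; (2) the pointwise spectral tail bound
`4π²(K²+1) ∫ ‖v − P_K v‖² ≤ ‖∇v‖₂²` in `ℝ≥0∞`.
[cite: FoiasManleyRosaTemam2001, Ch. IV (1.14) p. 193; App. B.1] -/
theorem stub_projectedStress :
    (∀ (g : Vec3), Torus.IsSmooth g → ∃ C : ℝ, 0 ≤ C ∧ ∀ K : ℕ, ∃ (q : H3 → ℝ) (B : ℝ),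
      Continuous q ∧ (∀ v : H3, |q v| ≤ B * Torus.truncNormSq K v) ∧
      ∀ v : H3, |Torus.inertialPairing (v : L2) g - q v| ≤
        C * ‖v‖ * Real.sqrt (∫ x, ‖(((v : L2)) : Vec3) x - Torus.fourierTruncate K (((v : L2)) : Vec3) x‖ ^ 2)) ∧
    (∀ (K : ℕ) (v : H3),
      ENNReal.ofReal (4 * Real.pi ^ 2 * ((K : ℝ) ^ 2 + 1)) *
          ENNReal.ofReal (∫ x, ‖(((v : L2)) : Vec3) x - Torus.fourierTruncate K (((v : L2)) : Vec3) x‖ ^ 2) ≤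
        Torus.eGradNormSq (((v : L2)) : Vec3)) :=
  ⟨projectedStress_stress, projectedStress_tail⟩

end Summit.AnomalousDissipation.AnomalousDissipation.Theorems.TameRoughRigidity.TameClosure
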